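/-
Copyright (c) 2026 the pub-hodgecm-mathlib formalisation cell (harness21).  Prover seat hodgecm-mathlib-A-p03 (g24); LEAD F0P3a-plan (g9) WORD T8-20 (B) «SHED-1».
-/
import Summits.HodgeConjecture.HodgeConjecture.Theorems.F0P2oLocalLettersHold            -- ★ p839396 (B-p18 (LH)): `xiLocalPacket_nonsplit_isThetaPair_holds`, `keysCaseTwoReducible_holds` over ★ N3
import Summits.HodgeConjecture.HodgeConjecture.Theorems.F0P3bXiLocalPacketUnitaryOfStubs  -- ★ p830288: `xiLocalPacketUnitary_of_stubs` (XLPU ⟸ letter D + U1a + U1b)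
import Summits.HodgeConjecture.HodgeConjecture.Theorems.F0P3bOmegaLocUnitarizable         -- ★ p830233: U1a `isUnitarizable_omegaLoc_chiLocalSplittingsCM`
import Literature.RepresentationTheory.TwistedCoinvariantsUnitarizable                      -- ★ p829818: U1b `TwistedCoinv.isUnitarizable_rep`
import Summits.HodgeConjecture.HodgeConjecture.Theorems.F0P3LettersXiLocalPacketUnitary    -- ★ p823308: the LETTER `XiLocalPacketUnitary`
import Summits.HodgeConjecture.HodgeConjecture.Theorems.F0P3KeysCaseTwoOfStubs             -- ★ p834307: `keysCaseTwo_of_stubs` (Keys ⟸ N4 + N5)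
import Summits.HodgeConjecture.HodgeConjecture.Theorems.F0P3U3SquareIntegrableExponentsHolds  -- ★ p834912: N5 `u3SquareIntegrableExponents_holds` (hypothesis-free)
import HarnessLib

/-!
# Crux `H413`, P3 closer hygiene «SHED-1» — THE CLOSED N3 CONE OF `F0_U3LettersRung1` AS A THEOREMS FILE: `XiLocalPacketUnitary` and `KeysCaseTwo` HOLD, HYPOTHESIS-FREE

Cell `pub/hodgecm-mathlib` (D-0151), FLOOR 0, crux item H413 = `stmt-HodgeConjecture-24833`; LEAD F0P3a-plan (g9) WORD T8-20 (B) (2026-09-01): once the theta letter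
N3 #96 is ★ (`F0P2oLineJacquetHolds.thetaType_nonsplit_jacquetModule_holds`, F0P2-p06 (g4)), the whole cone `stub_N3 → stub_GR91D → stub_XLPU` and
`stub_N3 → stub_N4 → stub_Keys` of the rung-1 closer `Cruxes/H413/Lines/F0_U3LettersRung1.lean` (ED. 17 §C.4 ∕ §C.8) is CLOSED.  This file carries its two
consumed heads as hypothesis-free theorems whose TYPES ARE THE UNFOLDED TEXTS of the closer's `def StubXLPU` ∕ `def StubKeys` TOKEN FOR TOKEN (the closer's BY-NAME
CONTRACT), so that ED. 19 writes `theorem stub_XLPU : StubXLPU := F0P3N3ConeClosed.xiLocalPacketUnitary_holds` and `theorem stub_Keys : StubKeys :=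
F0P3N3ConeClosed.keysCaseTwo_holds` (δ-unfolding) and sheds the cone's bodies, docstrings and seven imports (census `CENSUS-SHED1-N3Cone.A-p03g24.md` 2367b50c:
195 923 B → 191 042 B (α) ∕ 189 963 B (β)).  The interior nodes are ★ already (B-p18 (LH) `F0P2oLocalLettersHold`, p839396): `xiLocalPacket_nonsplit_isThetaPair_holds`
(letter D, #104) and `keysCaseTwoReducible_holds` (N4, #106).  THEOREMS ONLY: no `def`, no instance, no notation, no named fact, no `sorry`; no `Cruxes/…/Lines` import
(O50-1); kernel lane `--supports stmt-HodgeConjecture-24833 --as helper`.  Bodies = the closer's `stub_XLPU` ∕ `stub_Keys` bodies with `stub_GR91D` ∕ `stub_N4`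
replaced by their ★ `_holds` twins.  HC_CM is proved only modulo the 2 remaining named inputs (hLiu418, h413) until rung 0 closes; this file pays no letter
(count-neutral hygiene: #96 ∕ #104 ∕ #106 were closed by the files it imports).

* `xiLocalPacketUnitary_holds` — «XiLocalPacketUnitary» (row #10-fin, ED. 7 text of `StubXLPU`) [Rogawski1990 §12.2 (1)(2) pp. 173–174; Lemma 4.13.1 (b); Prop. 13.1.3 (d)];
* `keysCaseTwo_holds` — Keys' case two `KeysCaseTwo L` at every CM field (text of `StubKeys`) [Keys1984 §7 Thm. p. 126; Rogawski1990 §12.2 (1)(2) pp. 173–174].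

## References
* [Rogawski1990] J. D. Rogawski, *Automorphic Representations of Unitary Groups in Three Variables*, Ann. of Math. Stud. 123 (1990), §12.2 (1)(2) pp. 173–174; Lemma 4.13.1 (b); Prop. 13.1.3 (d) p. 199.
* [GelbartRogawski1991] S. Gelbart, J. Rogawski, *L-functions and Fourier–Jacobi coefficients for the unitary group U(3)*, Invent. Math. 105 (1991), Lem. 5.1.2 p. 466; Cor. 5.2.2 p. 467.
* [Keys1984] D. Keys, *Principal series representations of special unitary groups over local fields*, Compositio Math. 51 (1984), §7 Thm. p. 126.
* [Casselman1995] W. Casselman, *Introduction to the theory of admissible representations of p-adic reductive groups* (1995), Thm. 4.4.6.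
-/

set_option autoImplicit false
-- the mandated namespace repeats the single-problem summit's segment (`HodgeConjecture.HodgeConjecture`)
set_option linter.dupNamespace false

noncomputable section

open MeasureTheory NumberField IsDedekindDomain
open Literature.NumberTheory.Automorphic Literature.NumberTheory.Automorphic.UnitaryGroup
open Literature.NumberTheory.Rogawski1990 Literature.NumberTheory.GaloisRepresentations
open scoped Matrix

namespace Summit.HodgeConjecture.HodgeConjecture.Cruxes.H413.F0P3N3ConeClosed

open Summit.HodgeConjecture.HodgeConjecture.Cruxes.H413

/-- **«XiLocalPacketUnitary» HOLDS, hypothesis-free** — the UNFOLDED text of the closer's `def StubXLPU` (ED. 7, token for token): at the letters' frame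
(`hH hHd μω hμu hres`, Borel ∕ Haar conventions `μZ`, Keys data `keys`), ★ `F0P3LettersXiLocalPacketUnitary.XiLocalPacketUnitary L H hH hHd μω hμu μZ keys`.
Proof = the closer's `stub_XLPU` body (★ `xiLocalPacketUnitary_of_stubs` over letter D, U1a ★ `isUnitarizable_omegaLoc_chiLocalSplittingsCM`, U1b ★
`TwistedCoinv.isUnitarizable_rep`) with letter D supplied by ★ `F0P2oLocalLettersHold.xiLocalPacket_nonsplit_isThetaPair_holds` (⟸ N3 #96 ★).
[cite: Rogawski1990, §12.2 (1)(2) pp. 173–174; Lemma 4.13.1 (b); Prop. 13.1.3 (d) p. 199] [cite: GelbartRogawski1991, Lem. 5.1.2 p. 466; Cor. 5.2.2 p. 467] -/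
theorem xiLocalPacketUnitary_holds :
  ∀ (L : Type) [Field L] [NumberField L] [IsCMField L] (H : Matrix (Fin 3) (Fin 3) L)
    (hH : (H.map (cmConjRingHom L))ᵀ = H) (hHd : IsUnit H.det) (μω : HeckeCharacter L) (hμu : μω.IsUnitary)
    (hres : ∀ x : Literature.NumberTheory.GaloisRepresentations.ideleGroup ↥(maximalRealSubfield L),
      μω (AdeleRing.ideleBaseChange (↥(maximalRealSubfield L)) L x) = quadraticHeckeCharCM L x)
    [∀ v : HeightOneSpectrum (𝓞 ↥(maximalRealSubfield L)), MeasurableSpace (Gqs L v ⧸ Subgroup.center (Gqs L v))]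
    [∀ v : HeightOneSpectrum (𝓞 ↥(maximalRealSubfield L)), BorelSpace (Gqs L v ⧸ Subgroup.center (Gqs L v))]
    (μZ : ∀ v : HeightOneSpectrum (𝓞 ↥(maximalRealSubfield L)), Measure (Gqs L v ⧸ Subgroup.center (Gqs L v)))
    [∀ v : HeightOneSpectrum (𝓞 ↥(maximalRealSubfield L)), (μZ v).IsHaarMeasure]
    (keys : ∀ (ξ : OneDimAutRepH L) (v : HeightOneSpectrum (𝓞 ↥(maximalRealSubfield L))),
      (∀ w : PlacesOver L v, IsCMField.complexConj L • w.1 = w.1) →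
        {p : IrrClass (Gqs L v) × IrrClass (Gqs L v) //
          KeysCaseTwoLabels L v (μω.semilocalComponent L v) (torusLocalComponent L (IsCMField.complexConj L) v ξ.η)
            (torusLocalComponent L (IsCMField.complexConj L) v ξ.ψ) p.1 p.2 ∧
          p.1.IsSquareIntegrable (μZ v) ∧ ¬ p.2.IsSquareIntegrable (μZ v)}),
    F0P3LettersXiLocalPacketUnitary.XiLocalPacketUnitary L H hH hHd μω hμu μZ keys :=
  fun L _ _ _ H hH hHd μω hμu hres _ _ μZ _ keys =>
    F0P3bXiLocalPacketUnitaryOfStubs.xiLocalPacketUnitary_of_stubs L H hH hHd μω hμu hres μZ keys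
      F0P2oLocalLettersHold.xiLocalPacket_nonsplit_isThetaPair_holds
      F0P3bOmegaLocUnitarizable.isUnitarizable_omegaLoc_chiLocalSplittingsCM
      (fun χ ρV hc hsm hρV => Literature.RepresentationTheory.TwistedCoinv.isUnitarizable_rep χ ρV hc hsm hρV)

/-- **Keys' case two HOLDS at every CM field, hypothesis-free** — the UNFOLDED text of the closer's `def StubKeys`: `∀ L, KeysCaseTwo L` (the unitary principal
series of the quasi-split `U(3)(L⁺_v)` at a non-split place has exactly two constituents, exactly one square-integrable).  Proof = the closer's `stub_Keys` body
(★ `F0P3KeysCaseTwoOfStubs.keysCaseTwo_of_stubs` over N4 and N5) with N4 supplied by ★ `F0P2oLocalLettersHold.keysCaseTwoReducible_holds` (⟸ N3 #96 ★) and N5 by ★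
`u3SquareIntegrableExponents_holds`. [cite: Keys1984, §7 Thm. p. 126] [cite: Rogawski1990, §12.2 (1)(2) pp. 173–174] [cite: Casselman1995, Thm. 4.4.6] -/
theorem keysCaseTwo_holds : ∀ (L : Type) [Field L] [NumberField L] [IsCMField L], KeysCaseTwo L :=
  fun L _ _ _ => F0P3KeysCaseTwoOfStubs.keysCaseTwo_of_stubs L (F0P2oLocalLettersHold.keysCaseTwoReducible_holds L)
    (F0P3U3SquareIntegrableExponentsHolds.u3SquareIntegrableExponents_holds L)

end Summit.HodgeConjecture.HodgeConjecture.Cruxes.H413.F0P3N3ConeClosed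

end
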